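import Literature.MathematicalPhysics.QuantumManyBody.EnergyLocalizationCellMethod
import Literature.MathematicalPhysics.QuantumManyBody.LiebYngvasonLowerBoundAssembly
import HarnessLib

/-!
# LSSY Lemma 5.2 (localization of energy): the proof assembled

Topic `Literature/MathematicalPhysics/QuantumManyBody`, proofs file of `EnergyLocalization.lean`
(named fact `LSSY2005_lemma52_periodic`, [LSSY2005, Lemma 5.2]; second ingredient of the provefact
`Literature.Barriers.AtomisticToContinuum.KineticGapLengthScales` = LSSY Thm. 5.1).

The printed proof [LSSY2005, p. 25]: for every symmetric normalised `Ψ`,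
`⟨Ψ,HΨ⟩ ≥ εT + (1-ε)(T^in + I) + (1-ε)T^out` (5.9), and
"by the estimates used for the proof of Theorem 2.4, in particular (2.47) and (2.53)–(2.58)",
`εT + (1-ε)(T^in + I) ≥ (1 - const·Y^{1/17}) 4πμρa` for `ε = Y^{1/17}`, `R = aY^{-5/17}`,
`N ≥ Y^{-1/17}` (5.14). The layers of that re-run of the proof of Thm. 2.4 for the localized
functional are `Dyson.dysonBound_boxN_inside` (`EnergyLocalizationDyson.lean`),
`locBoxLowerBound` (`EnergyLocalizationBoxBound.lean`), `locCellDecomposition` and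
`locSuperadditivity` (`EnergyLocalizationCellMethod.lean`). This file carries out (2.55)–(2.64)
for the localized functional (`locLowerBound_neumann`, the proof text of
`LSSY2005_lowerBound_neumann_of_parts` with the Dyson/encounter radius `R = aY^{-5/17} = a y⁻⁵`
instead of `ℓy ∈ [ay⁻⁵, 2ay⁻⁵]` — the cell side `ℓ` being rounded to fit `L = Mℓ` — which
costs a factor `8` in the Temple error, whence `C = 78` instead of `64`), and then the periodic
statement: a periodic state restricted to the cell is a Neumann trial state, `v ≤ v^per`,
`T ≥ εT + (1-ε)(T^in + T^out)`, so `⟨Ψ,HΨ⟩ ≥ E'(N,L) + (1-ε)T^out` (5.9); the hypothesis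
`N ≥ Y^{-1/17}` is the box-size condition `L/a > Y^{-6/17}` of Thm. 2.4, and for `Y ≥ δ` the
constant is taken so large that the bound is trivial (`LSSY2005_lemma52_periodic_holds`).

## References

* [LSSY2005] E. H. Lieb, R. Seiringer, J. P. Solovej, J. Yngvason, *The Mathematics of the Bose
  Gas and its Condensation*, Oberwolfach Seminars 34, Birkhäuser 2005 (arXiv:cond-mat/0610117):
  Lemma 5.2 (5.7)–(5.14), p. 25; Thm. 2.4 and (2.43)–(2.64), pp. 14–17.
-/

noncomputable section

open MeasureTheory Filter Metric
open scoped ENNReal NNReal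

namespace Literature.MathematicalPhysics.QuantumManyBody.BoseGas

/-! ### Superadditivity iterated -/

/-- Iterating superadditivity for the localized functional: `E'(qp + r, ℓ) ≥ q E'(p, ℓ)`
(the first inequality of (2.53'), for `E' = locGroundStateEnergy ε R v`).
[cite: LSSY2005, (2.53) and Lemma 5.2 (5.14)] -/
theorem locSuperadditivity_mul_le (ε R : ℝ) {v : ℝ → ℝ≥0∞} (hv : Measurable v) (ℓ : ℝ)
    (p q r : ℕ) :
    (q : ℝ≥0∞) * locGroundStateEnergy ε R v p ℓ ≤ locGroundStateEnergy ε R v (q * p + r) ℓ := by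
  induction q with
  | zero => simp
  | succ q ih =>
    calc ((q + 1 : ℕ) : ℝ≥0∞) * locGroundStateEnergy ε R v p ℓ
        = locGroundStateEnergy ε R v p ℓ + q * locGroundStateEnergy ε R v p ℓ := by
          push_cast; ring
      _ ≤ locGroundStateEnergy ε R v p ℓ + locGroundStateEnergy ε R v (q * p + r) ℓ := by
          gcongr
      _ ≤ locGroundStateEnergy ε R v (p + (q * p + r)) ℓ := locSuperadditivity ε R hv _ _ ℓ
      _ = locGroundStateEnergy ε R v ((q + 1) * p + r) ℓ := by congr 1; ring


/-! ### The parameters with `R = a y⁻⁵` ((2.59)–(2.64) for Lemma 5.2) -/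

/-- The shell for `R = ay⁻⁵`: `2R₀y⁵ ≤ a` gives `R₀ ≤ R/2`, and `ℓ ≤ 2ay⁻⁶` gives `R ≥ ℓy/2`,
hence `R³ - R₀³ ≥ (ℓy)³/16`. [cite: LSSY2005, (2.44), (2.63) and Lemma 5.2] -/
theorem lyK_shell_bound_in {a ℓ y R₀ : ℝ} (ha : 0 < a) (hy : 0 < y) (hℓ : 0 < ℓ)
    (hℓ2 : ℓ ≤ 2 * (a / y ^ 6))
    (hR₀ : 0 ≤ R₀) (hR₀a : 2 * R₀ * y ^ 5 ≤ a) :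
    R₀ ≤ a / y ^ 5 / 2 ∧ ℓ * y / 2 ≤ a / y ^ 5 ∧ (ℓ * y) ^ 3 / 16 ≤ (a / y ^ 5) ^ 3 - R₀ ^ 3 := by
  have hy5 : 0 < y ^ 5 := by positivity
  have hR₀R : R₀ ≤ a / y ^ 5 / 2 := by
    rw [le_div_iff₀ two_pos, le_div_iff₀ hy5]; linarith
  have hRℓ : ℓ * y / 2 ≤ a / y ^ 5 := by
    rw [le_div_iff₀ hy5]
    have h : ℓ * y ^ 6 ≤ 2 * a := by
      have := mul_le_mul_of_nonneg_right hℓ2 (pow_nonneg hy.le 6)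
      rwa [show 2 * (a / y ^ 6) * y ^ 6 = 2 * a by field_simp] at this
    nlinarith [h]
  refine ⟨hR₀R, hRℓ, ?_⟩
  set R := a / y ^ 5 with hR
  have hR0 : 0 ≤ R := by positivity
  have h3 : R₀ ^ 3 ≤ (R / 2) ^ 3 := pow_le_pow_left₀ hR₀ hR₀R 3
  have h4 : (ℓ * y / 2) ^ 3 ≤ R ^ 3 := pow_le_pow_left₀ (by positivity) hRℓ 3
  nlinarith [h3, h4, pow_nonneg hR0 3]

/-- Temple error for `R = ay⁻⁵`: with `D ≥ 2y/ℓ²`, `Δ ≥ (ℓy)³/16`, `a ≤ ℓy⁶`, `py ≤ 8`: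
`3ap/(πΔD) ≤ 64y`. [cite: LSSY2005, (2.49)–(2.50), (2.63) and Lemma 5.2] -/
theorem lyK_temple_error_bound_in {a ℓ y p D Δ : ℝ} (ha : 0 ≤ a) (hy : 0 < y) (hℓ : 0 < ℓ)
    (haℓ : a ≤ ℓ * y ^ 6) (hp8 : p * y ≤ 8) (hD : 2 * y / ℓ ^ 2 ≤ D)
    (hΔ : (ℓ * y) ^ 3 / 16 ≤ Δ) : 3 * a * p / (Real.pi * Δ * D) ≤ 64 * y := by
  have hpi3 := Real.pi_gt_three
  have hD0 : 0 < D := lt_of_lt_of_le (by positivity) hD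
  have hΔ0 : 0 < Δ := lt_of_lt_of_le (by positivity) hΔ
  have hden : 3 / 8 * ℓ * y ^ 4 ≤ Real.pi * Δ * D :=
    calc 3 / 8 * ℓ * y ^ 4 = 3 * ((ℓ * y) ^ 3 / 16) * (2 * y / ℓ ^ 2) := by field_simp; ring
      _ ≤ Real.pi * Δ * D := by gcongr
  rw [div_le_iff₀ (by positivity)]
  have h1 : 3 * a * p * y ≤ 64 * y * (3 / 8 * ℓ * y ^ 4) * y :=
    calc 3 * a * p * y = 3 * a * (p * y) := by ring
      _ ≤ 3 * a * 8 := by gcongr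
      _ ≤ 24 * (ℓ * y ^ 6) := by linarith
      _ = 64 * y * (3 / 8 * ℓ * y ^ 4) * y := by ring
  have h2 : 3 * a * p ≤ 64 * y * (3 / 8 * ℓ * y ^ 4) := le_of_mul_le_mul_right h1 hy
  exact h2.trans (mul_le_mul_of_nonneg_left hden (by positivity))

/-- **The parameter choice for Lemma 5.2**: as `lyK_parameters`, but with the Dyson/encounter
radius `R = ay⁻⁵` (= `aY^{-5/17}`) and a cell of side `ℓ ∈ [ay⁻⁶, 2ay⁻⁶]`; then the Temple
denominator is positive, the Temple error is `≤ 64y ≤ 1`, `R₀ < R`, `2R ≤ ℓ`,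
`4πR³/(3ℓ³) ≤ 1`, and `K(p,ℓ)(1 - 1/(ρℓ³)) ≥ 1 - 78y`.
[cite: LSSY2005, (2.59)–(2.64) and Lemma 5.2 (5.14)] -/
theorem lyK_parameters_in {a R₀ ℓ k y R ε : ℝ} {p : ℕ} (ha : 0 < a) (hy : 0 < y)
    (hy1 : y ≤ 1 / 64) (hℓ1 : a / y ^ 6 ≤ ℓ) (hℓ2 : ℓ ≤ 2 * (a / y ^ 6)) (hk1 : 3 / 16 / y ≤ k)
    (hk2 : k ≤ 2 / y) (hp : (p : ℝ) ≤ 4 * k) (hR₀ : 0 ≤ R₀) (hR₀a : 2 * R₀ * y ^ 5 ≤ a)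
    (hR : R = a / y ^ 5) (hε : ε = y) :
    0 < Real.pi * ε / ℓ ^ 2 - 4 * a * p * (p - 1) / ℓ ^ 3 ∧
    3 * a * p / (Real.pi * (R ^ 3 - R₀ ^ 3) *
      (Real.pi * ε / ℓ ^ 2 - 4 * a * p * (p - 1) / ℓ ^ 3)) ≤ 1 ∧
    R₀ < R ∧ 2 * R ≤ ℓ ∧ 4 * Real.pi * R ^ 3 / (3 * ℓ ^ 3) ≤ 1 ∧
    1 - 78 * y ≤ lyK a R₀ R ε ℓ p * (1 - 1 / k) := by
  subst hR hε
  have hpi4 := Real.pi_lt_four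
  have hy6 : 0 < ε ^ 6 := by positivity
  have hy5 : 0 < ε ^ 5 := by positivity
  have hℓ : 0 < ℓ := (div_pos ha hy6).trans_le hℓ1
  have haℓ : a ≤ ℓ * ε ^ 6 := by rwa [div_le_iff₀ hy6] at hℓ1
  have hε1 : ε ≤ 1 := hy1.trans (by norm_num)
  have hy3 : 256 * ε ^ 3 ≤ 1 := by
    have : ε ^ 3 ≤ (1 / 64) ^ 3 := pow_le_pow_left₀ hy.le hy1 3
    norm_num at this
    linarith
  have hk0 : 0 < k := lt_of_lt_of_le (by positivity) hk1
  have hp0 : (0 : ℝ) ≤ p := Nat.cast_nonneg p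
  have hp8 : (p : ℝ) * ε ≤ 8 := by
    have h8 : 4 * k ≤ 8 / ε := by rw [show (8 : ℝ) / ε = 4 * (2 / ε) by ring]; linarith
    have : (p : ℝ) ≤ 8 / ε := hp.trans h8
    rwa [le_div_iff₀ hy] at this
  set R := a / ε ^ 5 with hR_def
  have hR0 : 0 < R := by positivity
  have hRℓ : R ≤ ℓ * ε := by
    rw [hR_def, div_le_iff₀ hy5]; nlinarith [haℓ]
  have hRℓq : R / ℓ ≤ ε := by rw [div_le_iff₀ hℓ]; linarith
  have hD2 := lyK_temple_denominator_bound ha.le hy hy3 hℓ haℓ hp0 hp8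
  obtain ⟨hR₀R, -, hΔ⟩ := lyK_shell_bound_in ha hy hℓ hℓ2 hR₀ hR₀a
  have hT64 := lyK_temple_error_bound_in ha.le hy hℓ haℓ hp8 hD2 hΔ
  have hD : 0 < Real.pi * ε / ℓ ^ 2 - 4 * a * p * (p - 1) / ℓ ^ 3 :=
    lt_of_lt_of_le (by positivity) hD2
  have hR₀ltR : R₀ < R := hR₀R.trans_lt (by linarith)
  have h2R : 2 * R ≤ ℓ := by nlinarith [hRℓ, hℓ]
  have hq_le : 4 * Real.pi * R ^ 3 / (3 * ℓ ^ 3) ≤ 4 * Real.pi / 3 * ε ^ 3 := by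
    rw [div_le_iff₀ (by positivity)]
    have h3 : R ^ 3 ≤ (ℓ * ε) ^ 3 := pow_le_pow_left₀ hR0.le hRℓ 3
    nlinarith [h3, Real.pi_pos]
  have hq3 : 4 * Real.pi / 3 * ε ^ 3 ≤ 1 := by
    have h8 : ε ^ 3 ≤ 1 / 8 := by
      have := pow_le_pow_left₀ hy.le (hy1.trans (by norm_num : (1 : ℝ) / 64 ≤ 1 / 2)) 3
      norm_num at this; exact this
    calc 4 * Real.pi / 3 * ε ^ 3 ≤ 4 * 4 / 3 * (1 / 8) := by gcongr
      _ ≤ 1 := by norm_num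
  refine ⟨hD, hT64.trans (by linarith), hR₀ltR, h2R, hq_le.trans hq3, ?_⟩
  -- the five factors
  have hF2 : 1 - 6 * ε ≤ (1 - 2 * R / ℓ) ^ 3 := by
    have hle : 1 - 2 * ε ≤ 1 - 2 * R / ℓ := by rw [mul_div_assoc]; linarith
    have h0 : 0 ≤ 1 - 2 * ε := by linarith
    have : (1 - 2 * ε) ^ 3 = 1 - 6 * ε + ε ^ 2 * (12 - 8 * ε) := by ring
    have hnn : 0 ≤ ε ^ 2 * (12 - 8 * ε) := mul_nonneg (sq_nonneg ε) (by linarith)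
    calc 1 - 6 * ε ≤ (1 - 2 * ε) ^ 3 := by linarith
      _ ≤ (1 - 2 * R / ℓ) ^ 3 := pow_le_pow_left₀ h0 hle 3
  have hF3 : 1 - ε ≤ (1 - 4 * Real.pi * R ^ 3 / (3 * ℓ ^ 3)) ^ (p - 1) := by
    calc 1 - ε ≤ (1 - 4 * Real.pi / 3 * ε ^ 3) ^ (p - 1) := lyK_shell_probability_bound hy hy1 hp8
      _ ≤ (1 - 4 * Real.pi * R ^ 3 / (3 * ℓ ^ 3)) ^ (p - 1) :=
          pow_le_pow_left₀ (by linarith) (by linarith) _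
  have hF4 : 1 - 64 * ε ≤ 1 - 3 * a * p / (Real.pi * (R ^ 3 - R₀ ^ 3) *
      (Real.pi * ε / ℓ ^ 2 - 4 * a * p * (p - 1) / ℓ ^ 3)) := by linarith
  have hF5 : 1 - 16 / 3 * ε ≤ 1 - 1 / k := by
    have : 1 / k ≤ 16 / 3 * ε := by
      rw [div_le_iff₀ hk0]
      calc (1 : ℝ) = 16 / 3 * ε * (3 / 16 / ε) := by field_simp
        _ ≤ 16 / 3 * ε * k := by gcongr
    linarith
  unfold lyK
  obtain ⟨h12₀, h12⟩ := one_sub_add_le_mul (sub_nonneg.2 hε1) le_rfl hF2 hy.le (by positivity)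
    (by linarith)
  obtain ⟨h123₀, h123⟩ := one_sub_add_le_mul h12₀ h12 hF3 (by positivity) hy.le hε1
  obtain ⟨h1234₀, h1234⟩ := one_sub_add_le_mul h123₀ h123 hF4 (by positivity) (by positivity)
    (by linarith)
  obtain ⟨-, h12345⟩ := one_sub_add_le_mul h1234₀ h1234 hF5 (by positivity) (by positivity)
    (by linarith)
  linarith

/-! ### (2.55)–(2.64) for the localized functional -/

set_option maxHeartbeats 800000 in
/-- **The Lieb–Yngvason bound for the localized functional** (the content of (5.14)): there are
`δ, C > 0` (here `C = 78`, `δ = (a/(2R₀+a))^{17/5}`) such that for all `N` and `L > 0` with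
`Y < δ` and `L/a > Y^{-6/17}`,
`inf_Ψ [εT + (1-ε)(T^in_R + I)] ≥ 4πρa (1 - C Y^{1/17}) N` on the Neumann box `Λ_L^N`, for
`ε = Y^{1/17}`, `R = aY^{-5/17}` — the proof of Thm. 2.4 ((2.52)–(2.64)) run for the localized
functional. [cite: LSSY2005, Lemma 5.2 (5.14) and Thm. 2.4 (2.52)–(2.64)] -/
theorem locLowerBound_neumann (v : ℝ → ℝ≥0∞) (hv : IsRepulsiveFiniteRange v) :
    ∃ δ C : ℝ, 0 < δ ∧ 0 < C ∧
      ∀ (N : ℕ) (L : ℝ), 0 < L →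
        let a := (scatteringLength v).toReal
        let ρ := (N : ℝ) / L ^ 3
        let Y := 4 * Real.pi * ρ * a ^ 3 / 3
        Y < δ → Y ^ (-(6 : ℝ) / 17) < L / a →
        ENNReal.ofReal (4 * Real.pi * ρ * a * (1 - C * Y ^ ((1 : ℝ) / 17)) * N) ≤
          locGroundStateEnergy (Y ^ ((1 : ℝ) / 17)) (a * Y ^ (-(5 : ℝ) / 17)) v N L := by
  obtain ⟨hmeas, R₀', hR₀'⟩ := hv
  set R₀ := max R₀' 0 with hR₀_def
  have hR₀ : 0 ≤ R₀ := le_max_right _ _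
  have hvR₀ : ∀ r, R₀ < r → v r = 0 := fun r hr => hR₀' r ((le_max_left _ _).trans_lt hr)
  rcases (ENNReal.toReal_nonneg : 0 ≤ (scatteringLength v).toReal).eq_or_lt with ha | ha
  · -- `a = 0`: the hypothesis `L/a > C' Y^{-6/17}` reads `0 < 0`
    refine ⟨1, 1, one_pos, one_pos, ?_⟩
    intro N L hL a ρ Y hY hL'
    exfalso
    have haz : a = 0 := ha.symm
    have hYz : Y = 0 := by
      show 4 * Real.pi * ρ * a ^ 3 / 3 = 0
      rw [haz]; ring
    have h : Y ^ (-(6 : ℝ) / 17) < L / a := hL'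
    rw [hYz, haz, div_zero, Real.zero_rpow (by norm_num)] at h
    exact lt_irrefl 0 h
  -- `a > 0`
  refine ⟨((scatteringLength v).toReal / (2 * R₀ + (scatteringLength v).toReal)) ^ ((17 : ℝ) / 5),
    78, by positivity, by norm_num, ?_⟩
  intro N L hL a ρ Y hY hL'
  change 0 < a at ha
  change Y < (a / (2 * R₀ + a)) ^ ((17 : ℝ) / 5) at hY
  change Y ^ (-(6 : ℝ) / 17) < L / a at hL'
  show ENNReal.ofReal (4 * Real.pi * ρ * a * (1 - 78 * Y ^ ((1 : ℝ) / 17)) * N) ≤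
    locGroundStateEnergy (Y ^ ((1 : ℝ) / 17)) (a * Y ^ (-(5 : ℝ) / 17)) v N L
  have ha_def : a = (scatteringLength v).toReal := rfl
  have hρ_def : ρ = N / L ^ 3 := rfl
  have hY_def : Y = 4 * Real.pi * ρ * a ^ 3 / 3 := rfl
  clear_value Y ρ a
  -- `N = 0` is trivial
  rcases Nat.eq_zero_or_pos N with hN0 | hNpos
  · subst hN0; simp
  have hN : (0 : ℝ) < N := Nat.cast_pos.2 hNpos
  have hρ : 0 < ρ := by rw [hρ_def]; positivity
  have hY0 : 0 < Y := by rw [hY_def]; positivity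
  -- exponent bookkeeping, `y = Y^{1/17}`; the range condition
  have hR₀a := lyK_range_bound hY0.le ha hR₀ hY
  obtain ⟨hY17, hY6, -⟩ := rpow_seventeenth hY0.le
  have hY5 : Y ^ (-(5 : ℝ) / 17) = ((Y ^ ((1 : ℝ) / 17)) ^ 5)⁻¹ := by
    rw [← Real.rpow_natCast, ← Real.rpow_mul hY0.le, ← Real.rpow_neg hY0.le]; norm_num
  rw [hY5]
  set y := Y ^ ((1 : ℝ) / 17) with hy_def
  have hy : 0 < y := Real.rpow_pos_of_pos hY0 _
  set R := a / y ^ 5 with hR_def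
  rw [show a * (y ^ 5)⁻¹ = R by rw [hR_def, div_eq_mul_inv]]
  -- if `1 - C y ≤ 0` the bound is trivial; otherwise `y < 1/64` is all the smallness needed
  rcases le_or_gt (1 - 78 * y) 0 with hsmall | hpos
  · have : 4 * Real.pi * ρ * a * (1 - 78 * y) * N ≤ 0 :=
      mul_nonpos_of_nonpos_of_nonneg
        (mul_nonpos_of_nonneg_of_nonpos (by positivity) hsmall) hN.le
    rw [ENNReal.ofReal_of_nonpos this]
    exact bot_le
  have hy1 : y ≤ 1 / 64 := by linarith
  have hy_lt1 : y < 1 := by linarith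
  have hρa : ρ * a ^ 3 = 3 / (4 * Real.pi) * y ^ 17 := by
    rw [hY17, hY_def]; field_simp
  -- the cells: `ℓ₀ = a y⁻⁶ < L`, `L = M ℓ`, `ℓ₀ ≤ ℓ ≤ 2ℓ₀`
  have hℓ₀ : 0 < a / y ^ 6 := by positivity
  have hLℓ₀ : a / y ^ 6 < L := by
    rw [hY6, lt_div_iff₀ ha] at hL'
    rwa [div_eq_inv_mul]
  obtain ⟨M, hM0, hMℓ, hℓ1, hℓ2⟩ := exists_cell_number hℓ₀ hLℓ₀
  set ℓ := L / M with hℓ_def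
  have hMr : (0 : ℝ) < M := Nat.cast_pos.2 hM0
  have hℓ : 0 < ℓ := hℓ₀.trans_le hℓ1
  -- particles per cell `k = ρℓ³ = N/M³`, and `p = ⌊4k⌋`
  obtain ⟨hk1, hk2⟩ := lyK_particle_number_bounds hρ ha hy hρa hℓ1 hℓ2
  set k := ρ * ℓ ^ 3 with hkρ
  have hkM : k * (M : ℝ) ^ 3 = N := by
    rw [hkρ, hρ_def, ← hMℓ]; field_simp
  have hk12 : (12 : ℝ) ≤ k := by
    refine le_trans ?_ hk1
    rw [le_div_iff₀ hy]; linarith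
  set p := ⌊4 * k⌋₊ with hp_def
  have hp_le : (p : ℝ) ≤ 4 * k := Nat.floor_le (by positivity)
  have hp_ge : 4 * k - 1 ≤ p := by have := Nat.lt_floor_add_one (4 * k); linarith
  have hp1 : 1 ≤ p := by rw [hp_def, Nat.one_le_floor_iff]; linarith
  -- the parameters `ε = y`, `R = a y⁻⁵` and the estimate (2.64)
  obtain ⟨hD, hT, hR₀R, h2R', hq1, hmain⟩ :=
    lyK_parameters_in (R := R) (ε := y) (p := p) ha hy hy1 hℓ1 hℓ2 hk1 hk2 hp_le hR₀ hR₀a rfl rfl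
  have h2R : 2 * R < ℓ := by
    have hRℓ : R ≤ ℓ * y := by
      rw [hR_def, div_le_iff₀ (by positivity)]
      have : a ≤ ℓ * y ^ 6 := by rwa [div_le_iff₀ (by positivity)] at hℓ1
      nlinarith [this]
    have : ℓ * (2 * y) < ℓ * 1 := mul_lt_mul_of_pos_left (by linarith) hℓ
    linarith
  set Kp := lyK a R₀ R y ℓ p with hKp_def
  obtain ⟨hKp0, -⟩ := lyK_anti ha.le hy_lt1.le hℓ h2R.le hR₀ hR₀R hq1 hD hT le_rfl
  set c := 4 * Real.pi * a / ℓ ^ 3 * Kp with hc_def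
  have hc0 : 0 ≤ c := mul_nonneg (by positivity) hKp0
  -- Step 1: the box bound (2.54)–(2.55) for `n ≤ p` and superadditivity (2.53)
  have hbox : ∀ n : ℕ, n ≤ p →
      ENNReal.ofReal (c * n * (n - 1)) ≤ locGroundStateEnergy y R v n ℓ := by
    intro n hn
    obtain ⟨-, hKn⟩ := lyK_anti ha.le hy_lt1.le hℓ h2R.le hR₀ hR₀R hq1 hD hT hn
    have hDn := hD.trans_le (temple_denominator_anti (ε := y) ha.le hℓ hn)
    rw [ha_def] at hDn
    have hBn := locBoxLowerBound v R₀ hmeas hR₀ hvR₀ n ℓ y R hy hy_lt1 hR₀R h2R hDn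
    rw [← ha_def] at hBn
    refine le_trans (ENNReal.ofReal_le_ofReal ?_) hBn
    have hnn : (0 : ℝ) ≤ n * (n - 1) := by
      rcases Nat.eq_zero_or_pos n with h0 | h0
      · subst h0; simp
      · have : (1 : ℝ) ≤ n := by exact_mod_cast h0
        exact mul_nonneg (by positivity) (by linarith)
    calc c * n * (n - 1) = 4 * Real.pi * a / ℓ ^ 3 * (n * (n - 1)) * Kp := by rw [hc_def]; ring
      _ ≤ 4 * Real.pi * a / ℓ ^ 3 * (n * (n - 1)) * lyK a R₀ R y ℓ n :=
          mul_le_mul_of_nonneg_left hKn (mul_nonneg (by positivity) hnn)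
      _ = 4 * Real.pi * a / ℓ ^ 3 * n * (n - 1) * lyK a R₀ R y ℓ n := by ring
  have hsup : ∀ q r : ℕ, (q : ℝ≥0∞) * locGroundStateEnergy y R v p ℓ ≤
      locGroundStateEnergy y R v (q * p + r) ℓ := fun q r => locSuperadditivity_mul_le y R hmeas ℓ p q r
  have haff := affine_lowerBound_of_box_of_superadditive
    (E := fun n => locGroundStateEnergy y R v n ℓ) hc0 hp_ge hp1 hbox hsup
  -- Step 2: the cell method (2.52)
  have hcell := locCellDecomposition y R hmeas N M hM0 hℓ
  rw [hMℓ] at hcell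
  have hα : 0 ≤ c * (2 * k - 1) := mul_nonneg hc0 (by linarith)
  have hbig := cell_lowerBound_of_affine (ι := Fin (M ^ 3))
    (E := fun n => locGroundStateEnergy y R v n ℓ) (β := ENNReal.ofReal (c * k ^ 2)) hα haff hcell
  have hβ : (Fintype.card (Fin (M ^ 3)) : ℝ≥0∞) * ENNReal.ofReal (c * k ^ 2) =
      ENNReal.ofReal ((M : ℝ) ^ 3 * (c * k ^ 2)) := by
    rw [Fintype.card_fin, ← ENNReal.ofReal_natCast,
      ← ENNReal.ofReal_mul (p := ((M ^ 3 : ℕ) : ℝ)) (by positivity), Nat.cast_pow]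
  rw [hβ] at hbig
  -- Step 4: (2.58) with (2.64)
  have hreal := lyK_final_algebra (M := (M : ℝ)) (C := 78) hρ ha.le hℓ hN.le rfl hkM hmain
  calc ENNReal.ofReal (4 * Real.pi * ρ * a * (1 - 78 * y) * N)
      ≤ ENNReal.ofReal (c * (2 * k - 1) * N - (M : ℝ) ^ 3 * (c * k ^ 2)) :=
        ENNReal.ofReal_le_ofReal hreal
    _ = ENNReal.ofReal (c * (2 * k - 1) * N) - ENNReal.ofReal ((M : ℝ) ^ 3 * (c * k ^ 2)) :=
        ENNReal.ofReal_sub _ (mul_nonneg (by positivity) (mul_nonneg hc0 (sq_nonneg k)))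
    _ ≤ locGroundStateEnergy y R v N L + ENNReal.ofReal ((M : ℝ) ^ 3 * (c * k ^ 2)) -
          ENNReal.ofReal ((M : ℝ) ^ 3 * (c * k ^ 2)) := tsub_le_tsub_right hbig _
    _ = locGroundStateEnergy y R v N L := ENNReal.add_sub_cancel_right ENNReal.ofReal_ne_top
/-! ### The periodic statement: Lemma 5.2 -/

/-- **(5.9) for a periodic state.** Restricted to the cell, a periodic trial state is a Neumann
trial state (`PeriodicTrialState.toNeumann`), `v ≤ v^per`, and `T ≥ εT + (1-ε)(T^in + T^out)`, so
`⟨Ψ, HΨ⟩ ≥ [εT + (1-ε)(T^in + I)](Ψ|_{Λ^N}) + (1-ε) T^out` for `0 ≤ ε ≤ 1`.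
[cite: LSSY2005, Lemma 5.2 (5.9)–(5.13)] -/
theorem locEnergy_toNeumann_add_le_periodicEnergy {ε : ℝ} (hε0 : 0 ≤ ε) (hε1 : ε ≤ 1) (R : ℝ)
    {v : ℝ → ℝ≥0∞} (hv : Measurable v) {N : ℕ} {L : ℝ} (Ψ : PeriodicTrialState N L) :
    locEnergy ε R v Ψ.toNeumann +
        ENNReal.ofReal (1 - ε) * ∫⁻ X in cellN N L, kineticOutside R Ψ.ψ X ≤
      periodicEnergy v Ψ := by
  have hbox : ∀ F : Config N → ℝ≥0∞, ∫⁻ X in boxN N L, F X = ∫⁻ X in cellN N L, F X :=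
    fun F => setLIntegral_congr (boxN_ae_eq_cellN N L)
  have hsplit : ENNReal.ofReal ε + ENNReal.ofReal (1 - ε) = 1 := by
    rw [← ENNReal.ofReal_add hε0 (by linarith), add_sub_cancel, ENNReal.ofReal_one]
  have hle1 : ENNReal.ofReal (1 - ε) ≤ 1 := ENNReal.ofReal_le_one.2 (by linarith)
  have hm1 : Measurable fun X => ENNReal.ofReal ε * kineticDensity Ψ.ψ X :=
    (measurable_kineticDensity Ψ.contDiff).const_mul _
  have hm2 : Measurable fun X => ENNReal.ofReal (1 - ε) *
      (kineticInside R Ψ.ψ X + interaction v X * (‖Ψ.ψ X‖₊ : ℝ≥0∞) ^ 2) :=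
    ((measurable_kineticInside R Ψ.ψ).add
      ((measurable_interaction hv).mul (measurable_normSq Ψ.contDiff.continuous))).const_mul _
  -- everything as one integral over the cell
  have hE : locEnergy ε R v Ψ.toNeumann +
      ENNReal.ofReal (1 - ε) * ∫⁻ X in cellN N L, kineticOutside R Ψ.ψ X =
      ∫⁻ X in cellN N L, (ENNReal.ofReal ε * kineticDensity Ψ.ψ X +
        ENNReal.ofReal (1 - ε) *
          (kineticInside R Ψ.ψ X + interaction v X * (‖Ψ.ψ X‖₊ : ℝ≥0∞) ^ 2)) +
        ENNReal.ofReal (1 - ε) * kineticOutside R Ψ.ψ X := by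
    unfold locEnergy
    change ENNReal.ofReal ε * (∫⁻ X in boxN N L, kineticDensity Ψ.ψ X) +
      ENNReal.ofReal (1 - ε) * (∫⁻ X in boxN N L,
        kineticInside R Ψ.ψ X + interaction v X * (‖Ψ.ψ X‖₊ : ℝ≥0∞) ^ 2) + _ = _
    have hm12 : Measurable fun X => ENNReal.ofReal ε * kineticDensity Ψ.ψ X +
        ENNReal.ofReal (1 - ε) *
          (kineticInside R Ψ.ψ X + interaction v X * (‖Ψ.ψ X‖₊ : ℝ≥0∞) ^ 2) := hm1.add hm2
    rw [hbox, hbox, ← lintegral_const_mul' _ _ ENNReal.ofReal_ne_top,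
      ← lintegral_const_mul' _ _ ENNReal.ofReal_ne_top,
      ← lintegral_const_mul' _ _ ENNReal.ofReal_ne_top, ← lintegral_add_left hm1,
      ← lintegral_add_left hm12]
  rw [hE]
  refine lintegral_mono fun X => ?_
  have hT := kineticInside_add_kineticOutside_le R Ψ.ψ X
  have hV := interaction_le_periodicInteraction v L X
  calc ENNReal.ofReal ε * kineticDensity Ψ.ψ X + ENNReal.ofReal (1 - ε) *
        (kineticInside R Ψ.ψ X + interaction v X * (‖Ψ.ψ X‖₊ : ℝ≥0∞) ^ 2) +
        ENNReal.ofReal (1 - ε) * kineticOutside R Ψ.ψ X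
      = ENNReal.ofReal ε * kineticDensity Ψ.ψ X +
          ENNReal.ofReal (1 - ε) * (kineticInside R Ψ.ψ X + kineticOutside R Ψ.ψ X) +
          ENNReal.ofReal (1 - ε) * (interaction v X * (‖Ψ.ψ X‖₊ : ℝ≥0∞) ^ 2) := by ring
    _ ≤ ENNReal.ofReal ε * kineticDensity Ψ.ψ X + ENNReal.ofReal (1 - ε) * kineticDensity Ψ.ψ X +
          1 * (periodicInteraction v L X * (‖Ψ.ψ X‖₊ : ℝ≥0∞) ^ 2) := by
        gcongr
    _ = kineticDensity Ψ.ψ X + periodicInteraction v L X * (‖Ψ.ψ X‖₊ : ℝ≥0∞) ^ 2 := by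
        rw [← add_mul, hsplit, one_mul, one_mul]

/-- Exponent bookkeeping: `Y^{-18/17} = (Y^{-6/17})³ = Y⁻¹ Y^{-1/17}` (`Y > 0`). [folklore] -/
theorem rpow_eighteen_seventeenth {Y : ℝ} (hY : 0 < Y) :
    (Y ^ (-(6 : ℝ) / 17)) ^ 3 = Y⁻¹ * Y ^ (-(1 : ℝ) / 17) := by
  rw [← Real.rpow_natCast, ← Real.rpow_mul hY.le, ← Real.rpow_neg_one, ← Real.rpow_add hY]
  norm_num

/-- **The hypothesis `N ≥ Y^{-1/17}` of Lemma 5.2 is the box-size condition of Thm. 2.4**: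
`(L/a)³ = N/(ρa³) = 4πN/(3Y) ≥ (4π/3) Y^{-18/17} > (Y^{-6/17})³`. [cite: LSSY2005, Lemma 5.2 and Thm. 2.4] -/
theorem rpow_lt_div_of_le {N : ℕ} {L a : ℝ} (hN : 0 < N) (hL : 0 < L) (ha : 0 < a)
    (h : (4 * Real.pi * ((N : ℝ) / L ^ 3) * a ^ 3 / 3) ^ (-(1 : ℝ) / 17) ≤ N) :
    (4 * Real.pi * ((N : ℝ) / L ^ 3) * a ^ 3 / 3) ^ (-(6 : ℝ) / 17) < L / a := by
  set Y := 4 * Real.pi * ((N : ℝ) / L ^ 3) * a ^ 3 / 3 with hY_def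
  have hNr : (0 : ℝ) < N := Nat.cast_pos.2 hN
  have hY : 0 < Y := by rw [hY_def]; positivity
  have hcube : (L / a) ^ 3 = 4 * Real.pi / 3 * N * Y⁻¹ := by
    rw [hY_def]; field_simp
  have hpi3 := Real.pi_gt_three
  refine lt_of_pow_lt_pow_left₀ 3 (by positivity) ?_
  rw [rpow_eighteen_seventeenth hY, hcube]
  have h1 : Y⁻¹ * Y ^ (-(1 : ℝ) / 17) ≤ Y⁻¹ * N :=
    mul_le_mul_of_nonneg_left h (inv_pos.2 hY).le
  have h2 : Y⁻¹ * (N : ℝ) < 4 * Real.pi / 3 * N * Y⁻¹ := by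
    have : (1 : ℝ) < 4 * Real.pi / 3 := by linarith
    nlinarith [mul_pos (inv_pos.2 hY) hNr]
  exact h1.trans_lt h2

/-- **LSSY 2005, Lemma 5.2 (localization of energy), periodic case — the named fact
`LSSY2005_lemma52_periodic` of `EnergyLocalization.lean` holds.** For `v ≥ 0` of finite range with
`a < ∞` there is `C` such that for all `N`, `L > 0` with `N ≥ Y^{-1/17}` and every periodic
`Ψ`: `⟨Ψ,HΨ⟩ ≥ (1 - CY^{1/17})(4πρaN + ∑ᵢ∫1{tᵢ ≥ R}|∇ᵢΨ|²)`, `R = aY^{-5/17}`.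
[cite: LSSY2005, Lemma 5.2 (5.7)–(5.14)] -/
theorem LSSY2005_lemma52_periodic_holds : LSSY2005_lemma52_periodic := by
  intro v hv hfin
  have hmeas : Measurable v := hv.1
  obtain ⟨δ, C, hδ, hC, H⟩ := locLowerBound_neumann v hv
  set C' : ℝ := C + δ ^ (-(1 : ℝ) / 17) + 1 with hC'_def
  have hδ17 : 0 < δ ^ (-(1 : ℝ) / 17) := Real.rpow_pos_of_pos hδ _
  have hC'C : C ≤ C' := by rw [hC'_def]; linarith
  have hC'1 : 1 ≤ C' := by rw [hC'_def]; linarith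
  have hC'δ : δ ^ (-(1 : ℝ) / 17) ≤ C' := by rw [hC'_def]; linarith
  refine ⟨C', by linarith, ?_⟩
  intro N L hL a ρ Y hYN Ψ
  have ha_def : a = (scatteringLength v).toReal := rfl
  have hρ_def : ρ = N / L ^ 3 := rfl
  have hY_def : Y = 4 * Real.pi * ρ * a ^ 3 / 3 := rfl
  have ha0 : 0 ≤ a := ENNReal.toReal_nonneg
  have hρ0 : 0 ≤ ρ := by rw [hρ_def]; positivity
  have hY0 : 0 ≤ Y := by rw [hY_def]; positivity
  set y := Y ^ ((1 : ℝ) / 17) with hy_def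
  have hy0 : 0 ≤ y := Real.rpow_nonneg hY0 _
  set R := a * Y ^ (-(5 : ℝ) / 17) with hR_def
  set Tout := ∫⁻ X in cellN N L, kineticOutside R Ψ.ψ X with hTout_def
  have hTout : Tout ≤ periodicEnergy v Ψ := lintegral_kineticOutside_le_periodicEnergy v R Ψ
  -- the generic fallback: the bound by `T^out ≤ ⟨Ψ,HΨ⟩` when the first term vanishes
  have hfallback : 4 * Real.pi * ρ * a * (1 - C' * y) * N ≤ 0 →
      ENNReal.ofReal (4 * Real.pi * ρ * a * (1 - C' * y) * N) + ENNReal.ofReal (1 - C' * y) * Tout ≤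
        periodicEnergy v Ψ := by
    intro h
    rw [ENNReal.ofReal_of_nonpos h, zero_add]
    calc ENNReal.ofReal (1 - C' * y) * Tout ≤ 1 * Tout :=
          mul_le_mul_left (ENNReal.ofReal_le_one.2 (by nlinarith [hC'1, hy0])) _
      _ ≤ periodicEnergy v Ψ := by rw [one_mul]; exact hTout
  -- trivial cases: the factor `1 - C'y ≤ 0`, or `a = 0`, or `N = 0`
  rcases le_or_gt (1 - C' * y) 0 with hfac | hfac
  · exact hfallback (mul_nonpos_of_nonpos_of_nonneg
      (mul_nonpos_of_nonneg_of_nonpos (by positivity) hfac) (Nat.cast_nonneg N))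
  rcases ha0.eq_or_lt with ha | ha
  · refine hfallback (le_of_eq ?_)
    rw [← ha]; ring
  rcases Nat.eq_zero_or_pos N with hN0 | hNpos
  · refine hfallback (le_of_eq ?_)
    rw [hN0]; simp
  -- main case
  have hNr : (0 : ℝ) < N := Nat.cast_pos.2 hNpos
  have hρ : 0 < ρ := by rw [hρ_def]; positivity
  have hYpos : 0 < Y := by rw [hY_def]; positivity
  have hy1 : y < 1 := by nlinarith [hC'1, hfac, hy0]
  have hε1 : y ≤ 1 := hy1.le
  -- `Y < δ`, for otherwise `C' y ≥ δ^{-1/17} δ^{1/17} = 1`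
  have hYδ : Y < δ := by
    by_contra hcon
    have hδY : δ ≤ Y := not_lt.1 hcon
    have h1 : δ ^ ((1 : ℝ) / 17) ≤ y := Real.rpow_le_rpow hδ.le hδY (by norm_num)
    have h2 : δ ^ (-(1 : ℝ) / 17) * δ ^ ((1 : ℝ) / 17) = 1 := by
      rw [← Real.rpow_add hδ]; norm_num
    have h3 : 1 ≤ C' * y := by
      calc (1 : ℝ) = δ ^ (-(1 : ℝ) / 17) * δ ^ ((1 : ℝ) / 17) := h2.symm
        _ ≤ C' * y := mul_le_mul hC'δ h1 (Real.rpow_nonneg hδ.le _) (by linarith)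
    linarith
  -- the box-size condition from `N ≥ Y^{-1/17}`
  have hL' : Y ^ (-(6 : ℝ) / 17) < L / a := rpow_lt_div_of_le hNpos hL ha hYN
  -- the bound for the localized functional, and (5.9)
  have hmain := H N L hL hYδ hL'
  have h59 := locEnergy_toNeumann_add_le_periodicEnergy hy0 hε1 R hmeas Ψ
  calc ENNReal.ofReal (4 * Real.pi * ρ * a * (1 - C' * y) * N) + ENNReal.ofReal (1 - C' * y) * Tout
      ≤ ENNReal.ofReal (4 * Real.pi * ρ * a * (1 - C * y) * N) + ENNReal.ofReal (1 - y) * Tout := by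
        have h1 : 4 * Real.pi * ρ * a * (1 - C' * y) * N ≤ 4 * Real.pi * ρ * a * (1 - C * y) * N := by
          have hP : 0 ≤ 4 * Real.pi * ρ * a * N := by positivity
          have hy' : 1 - C' * y ≤ 1 - C * y := by nlinarith [mul_nonneg (sub_nonneg.2 hC'C) hy0]
          calc 4 * Real.pi * ρ * a * (1 - C' * y) * N = 4 * Real.pi * ρ * a * N * (1 - C' * y) := by ring
            _ ≤ 4 * Real.pi * ρ * a * N * (1 - C * y) := mul_le_mul_of_nonneg_left hy' hP
            _ = _ := by ring
        have h2 : 1 - C' * y ≤ 1 - y := by nlinarith [hC'1, hy0]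
        exact add_le_add (ENNReal.ofReal_le_ofReal h1)
          (mul_le_mul_left (ENNReal.ofReal_le_ofReal h2) _)
    _ ≤ locGroundStateEnergy y R v N L + ENNReal.ofReal (1 - y) * Tout := by
        gcongr
    _ ≤ locEnergy y R v Ψ.toNeumann + ENNReal.ofReal (1 - y) * Tout := by
        gcongr; exact locGroundStateEnergy_le y R v Ψ.toNeumann
    _ ≤ periodicEnergy v Ψ := h59

end Literature.MathematicalPhysics.QuantumManyBody.BoseGas

end
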